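import Summits.ValiantsHypothesis.ValiantsHypothesis.Theorems.RefutationDegreeBeyondHessianNsJetCalibration
import Summits.ValiantsHypothesis.ValiantsHypothesis.Theorems.RefutationDegreeBeyondHessianNsStubDerivFunctional
import Summits.ValiantsHypothesis.ValiantsHypothesis.Theorems.RefutationDegreeBeyondHessianNsStubTranslFunctional
import Summits.ValiantsHypothesis.ValiantsHypothesis.Theorems.RefutationDegreeBeyondHessianNsStubNormalFormOfCorankOne
import Summits.ValiantsHypothesis.ValiantsHypothesis.Theorems.RefutationDegreeBeyondHessianNsStubIdentityTransfer
import Literature.Computability.AlgebraicComplexity.DeterminantalConormalBoundProofs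

/-!
# Route `RefutationDegree`, crux `BeyondHessianNs` (stmt-ValiantsHypothesis-5641), line `Sketch` —
# JET CALIBRATION IN JET FORM: a polynomial identity over `ℂ` IS a Nullstellensatz refutation

Helper file (no definitions), supporting `RefutationDegree.BeyondHessianNs`; assembles the four plumbing
stubs W1–W4 of skeleton v7 (`…StubDerivFunctional`, `…StubTranslFunctional`, `…StubNormalFormOfCorankOne`,
`…StubIdentityTransfer`) with JET CALIBRATION (`…JetCalibration.exists_refutation_of_separating`).

**Theorem** (`exists_refutation_of_jet_identity`). Let `m ≥ 1`, `i₀ ∈ [m]`, and let `y ∈ ℂ^{n × n}` be a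
SMOOTH zero of `per_n` (`per_n(y) = 0`, `∂_e per_n(y) ≠ 0` for some `e`). Let `Ψ̃` be a polynomial of
degree `≤ D` in the coefficients of a polynomial `g(x)` ("jet coordinates") such that

* `Ψ̃(coeff per_n(X + y)) ≠ 0`, and
* the POLYNOMIAL IDENTITY `Ψ̃(coeff det(Λ_{i₀} + Σ_e X_e Z_e)) = 0` holds for all complex matrices
  `Z_e ∈ ℂ^{m × m}` (`Λ_{i₀} = diag(1, …, 0_{i₀}, …, 1)`; the determinants of affine pencils in
  Landsberg–Ressayre normal form at the origin).

Then the coefficient system `Rep(n,m)` of `det A(x) - per_n(x)` (generic pencil) has a Nullstellensatz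
refutation `Σ_μ h_μ · coeff_μ P = 1` with all products of degree `≤ m (D + 1)`.

Proof. Put `Ψ := Ψ̃(T) · L` on (untranslated) coefficient space, where `T` is the translation
`g ↦ g(X + y)` as a linear substitution (W4) and `L` the linear form `g ↦ ∂_e g(y)` (W1), both exact on
polynomials of degree `≤ m + n`. Then `deg Ψ ≤ D + 1`, `Ψ(per_n) = Ψ̃(per_n(X + y)) · ∂_e per_n(y) ≠ 0`, and
for an affine pencil `A` over a field `K ⊇ ℂ` singular at `y`: if `adj A(y) = 0` then `L` kills it (Jacobi:
`∂_e det A (y) = tr(adj A(y) · A_e)`); otherwise `A(y)` has corank exactly one, `det A(X + y) =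
det(Λ_{i₀} + Σ_e X_e Z_e)` (W2), and the identity over `ℂ` transfers to `K` (W3). JET CALIBRATION finishes.

The crux `BeyondHessianNs` is thereby the POLYNOMIAL-IDENTITY HUNT `stub_polyJetEq` of skeleton v7: such
`Ψ̃` of degree `n^{O(1)}` at size `m = ⌊n²/2⌋ + 1` for all large `n`.
-/

noncomputable section

-- single-conjunct layout: Sub = Summit, duplicated namespace component intended
set_option linter.dupNamespace false

namespace Summit.ValiantsHypothesis.ValiantsHypothesis.Theorems.RefutationDegreeBeyondHessianNs

open MvPolynomial Matrix Literature.Computability.AlgebraicComplexity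

section Main

variable {n m : ℕ}

/-- The defect `P = det A(x) - per_n(x) ∈ R[x]` of the system `Rep(n,m)` (local notation; the crux
inlines it). -/
local notation3 (prettyPrint := false) "defect[" n ", " m "]" =>
  ((Matrix.of fun i j : Fin m =>
      MvPolynomial.C (MvPolynomial.X (none, (i, j))) +
        ∑ e : Fin n × Fin n, MvPolynomial.X e * MvPolynomial.C (MvPolynomial.X (some e, (i, j))) :
    Matrix (Fin m) (Fin m) (MvPolynomial (Fin n × Fin n)
      (MvPolynomial (Option (Fin n × Fin n) × (Fin m × Fin m)) ℂ))).det -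
    MvPolynomial.map MvPolynomial.C (Literature.Computability.AlgebraicComplexity.perPoly (Fin n) ℂ))

/-- Degree of the determinant of an `m × m` matrix of affine linear forms: `≤ m`. [folklore] -/
theorem totalDegree_det_le_of_affine {K : Type*} [CommRing K]
    (A : Matrix (Fin m) (Fin m) (MvPolynomial (Fin n × Fin n) K))
    (hA : ∀ i j, (A i j).totalDegree ≤ 1) : A.det.totalDegree ≤ m := by
  have h := Summit.ValiantsHypothesis.ValiantsHypothesis.Theorems.RefutationDegreeMrCalibration.totalDegree_det_le
    A (d := 1) hA
  simpa using h

/-- **JET CALIBRATION IN JET FORM** (line `Sketch`, skeleton v7 assembly). `m ≥ 1`, `i₀ ∈ [m]`, `y` a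
smooth zero of `per_n` (`∂_e per_n(y) ≠ 0`), `Ψ̃` of degree `≤ D` with `Ψ̃(coeff per_n(X + y)) ≠ 0` and
`Ψ̃(coeff det(Λ_{i₀} + Σ_e X_e Z_e)) = 0` for all complex `Z`. Then `Rep(n,m)` has a Nullstellensatz
refutation with products of degree `≤ m (D + 1)`. -/
theorem exists_refutation_of_jet_identity (hm : 0 < m) (i₀ : Fin m) (y : Fin n × Fin n → ℂ)
    (hy : eval y (perPoly (Fin n) ℂ) = 0) (e : Fin n × Fin n)
    (he : eval y (pderiv e (perPoly (Fin n) ℂ)) ≠ 0) {D : ℕ}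
    (Ψ : MvPolynomial (Fin n × Fin n →₀ ℕ) ℂ) (hΨD : Ψ.totalDegree ≤ D)
    (hΨper : eval (fun μ => coeff μ (transl y (perPoly (Fin n) ℂ))) Ψ ≠ 0)
    (hΨvan : ∀ Z : Fin n × Fin n → Matrix (Fin m) (Fin m) ℂ,
      eval (fun μ => coeff μ (((lamMatrix ℂ i₀).map C +
        ∑ e : Fin n × Fin n, (X e : MvPolynomial (Fin n × Fin n) ℂ) •
          (Z e).map (C : ℂ →+* MvPolynomial (Fin n × Fin n) ℂ) :
        Matrix (Fin m) (Fin m) (MvPolynomial (Fin n × Fin n) ℂ)).det)) Ψ = 0) :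
    ∃ hh : (Fin n × Fin n →₀ ℕ) → MvPolynomial (Option (Fin n × Fin n) × (Fin m × Fin m)) ℂ,
      (∀ μ, (hh μ * (defect[n, m]).coeff μ).totalDegree ≤ m * (D + 1)) ∧
        ∑ μ ∈ (defect[n, m]).support, hh μ * (defect[n, m]).coeff μ = 1 := by
  classical
  -- the plumbing (W1, W4, W3)
  obtain ⟨L, hLdeg, hL⟩ := stub_derivFunctional n (m + n) y e
  obtain ⟨T, hTdeg, hT⟩ := stub_translFunctional n (m + n) y
  have hW3 := stub_identityTransfer n m i₀ Ψ hΨvan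
  -- the separating polynomial on (untranslated) coefficient space
  set Ψ' : MvPolynomial (Fin n × Fin n →₀ ℕ) ℂ := aeval T Ψ * L with hΨ'
  refine exists_refutation_of_separating hm y hy Ψ' (D := D + 1) ?_ ?_ ?_
  · -- degree
    refine (totalDegree_mul _ _).trans (add_le_add ?_ hLdeg)
    simpa using totalDegree_aeval_le_mul Ψ hΨD T hTdeg
  · -- non-vanishing at `per_n`
    have hdegper : (perPoly (Fin n) ℂ).totalDegree ≤ m + n := by
      have h := (perPoly_isHomogeneous (n := Fin n) (k := ℂ)).totalDegree_le
      rw [Fintype.card_fin] at h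
      omega
    have hLper : eval (fun μ => coeff μ (perPoly (Fin n) ℂ)) L =
        eval y (pderiv e (perPoly (Fin n) ℂ)) := by
      simpa using hL ℂ (RingHom.id ℂ) (perPoly (Fin n) ℂ) hdegper
    have hTper : eval (fun μ => coeff μ (perPoly (Fin n) ℂ)) (aeval T Ψ) =
        eval (fun μ => coeff μ (transl y (perPoly (Fin n) ℂ))) Ψ := by
      rw [show aeval T Ψ = bind₁ T Ψ from rfl, eval, eval₂Hom_bind₁]
      show eval₂ (RingHom.id ℂ) (fun ν => eval (fun μ => coeff μ (perPoly (Fin n) ℂ)) (T ν)) Ψ = _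
      congr 1
      funext ν
      simpa using hT ℂ (RingHom.id ℂ) (perPoly (Fin n) ℂ) hdegper ν
    rw [hΨ', map_mul, hLper, hTper]
    exact mul_ne_zero hΨper he
  · -- vanishing on singular pencils over every field
    intro K _ φ A hA hdet
    rw [hΨ', eval₂_mul]
    have hdegA : A.det.totalDegree ≤ m + n :=
      (totalDegree_det_le_of_affine A hA).trans (Nat.le_add_right _ _)
    by_cases hadj : (A.map (eval fun s => φ (y s))).adjugate = 0
    · -- corank ≥ 2 at `y`: the derivative functional vanishes (Jacobi's formula)
      have hLA : eval₂ φ (fun μ => coeff μ A.det) L = 0 := by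
        rw [hL K φ A.det hdegA, DeterminantalConormal.eval_pderiv_det, hadj, Matrix.zero_mul,
          Matrix.trace_zero]
      rw [hLA, mul_zero]
    · -- corank exactly one at `y`: normal form (W2), translation (W4), identity transfer (W3)
      obtain ⟨Z, hZ⟩ := stub_normalFormOfCorankOne K n m i₀ (fun s => φ (y s)) A hA hdet hadj
      have hTA : eval₂ φ (fun μ => coeff μ A.det) (aeval T Ψ) =
          eval₂ φ (fun ν => coeff ν (transl (fun s => φ (y s)) A.det)) Ψ := by
        rw [show aeval T Ψ = bind₁ T Ψ from rfl, show eval₂ φ (fun μ => coeff μ A.det) (bind₁ T Ψ) =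
          eval₂Hom φ (fun μ => coeff μ A.det) (bind₁ T Ψ) from rfl, eval₂Hom_bind₁]
        show eval₂ φ (fun ν => eval₂Hom φ (fun μ => coeff μ A.det) (T ν)) Ψ = _
        congr 1
        funext ν
        exact hT K φ A.det hdegA ν
      rw [hTA, hZ, hW3 K φ Z, zero_mul]

/-- **The registered stub `stub_calibrationTranslated`** of line `Sketch` (skeleton v8): JET CALIBRATION IN
JET FORM, as registered on the crux item. -/
theorem stub_calibrationTranslated : ∀ (n m : ℕ), 0 < m → ∀ (i₀ : Fin m) (y : Fin n × Fin n → ℂ),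
    MvPolynomial.eval y (Literature.Computability.AlgebraicComplexity.perPoly (Fin n) ℂ) = 0 →
    ∀ (e : Fin n × Fin n), MvPolynomial.eval y (MvPolynomial.pderiv e
      (Literature.Computability.AlgebraicComplexity.perPoly (Fin n) ℂ)) ≠ 0 →
    ∀ (D : ℕ) (Ψ : MvPolynomial (Fin n × Fin n →₀ ℕ) ℂ), Ψ.totalDegree ≤ D →
    MvPolynomial.eval (fun μ => MvPolynomial.coeff μ
      (Literature.Computability.AlgebraicComplexity.transl y
        (Literature.Computability.AlgebraicComplexity.perPoly (Fin n) ℂ))) Ψ ≠ 0 →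
    (∀ Z : Fin n × Fin n → Matrix (Fin m) (Fin m) ℂ,
      MvPolynomial.eval (fun μ => MvPolynomial.coeff μ
        (((Literature.Computability.AlgebraicComplexity.lamMatrix ℂ i₀).map MvPolynomial.C +
          ∑ e : Fin n × Fin n, (MvPolynomial.X e : MvPolynomial (Fin n × Fin n) ℂ) •
            (Z e).map (MvPolynomial.C : ℂ →+* MvPolynomial (Fin n × Fin n) ℂ) :
            Matrix (Fin m) (Fin m) (MvPolynomial (Fin n × Fin n) ℂ)).det)) Ψ = 0) →
    ∃ hh : (Fin n × Fin n →₀ ℕ) → MvPolynomial (Option (Fin n × Fin n) × (Fin m × Fin m)) ℂ,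
      (∀ μ, (hh μ * MvPolynomial.coeff μ ((Matrix.of fun i j : Fin m =>
          MvPolynomial.C (MvPolynomial.X (none, (i, j))) +
            ∑ e : Fin n × Fin n, MvPolynomial.X e * MvPolynomial.C (MvPolynomial.X (some e, (i, j))) :
          Matrix (Fin m) (Fin m) (MvPolynomial (Fin n × Fin n)
            (MvPolynomial (Option (Fin n × Fin n) × (Fin m × Fin m)) ℂ))).det -
          MvPolynomial.map MvPolynomial.C
            (Literature.Computability.AlgebraicComplexity.perPoly (Fin n) ℂ))).totalDegree ≤
          m * (D + 1)) ∧
      ∑ μ ∈ ((Matrix.of fun i j : Fin m =>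
          MvPolynomial.C (MvPolynomial.X (none, (i, j))) +
            ∑ e : Fin n × Fin n, MvPolynomial.X e * MvPolynomial.C (MvPolynomial.X (some e, (i, j))) :
          Matrix (Fin m) (Fin m) (MvPolynomial (Fin n × Fin n)
            (MvPolynomial (Option (Fin n × Fin n) × (Fin m × Fin m)) ℂ))).det -
          MvPolynomial.map MvPolynomial.C
            (Literature.Computability.AlgebraicComplexity.perPoly (Fin n) ℂ)).support,
        hh μ * MvPolynomial.coeff μ ((Matrix.of fun i j : Fin m =>
          MvPolynomial.C (MvPolynomial.X (none, (i, j))) +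
            ∑ e : Fin n × Fin n, MvPolynomial.X e * MvPolynomial.C (MvPolynomial.X (some e, (i, j))) :
          Matrix (Fin m) (Fin m) (MvPolynomial (Fin n × Fin n)
            (MvPolynomial (Option (Fin n × Fin n) × (Fin m × Fin m)) ℂ))).det -
          MvPolynomial.map MvPolynomial.C
            (Literature.Computability.AlgebraicComplexity.perPoly (Fin n) ℂ)) = 1 :=
  fun _ _ hm i₀ y hy e he _ Ψ hΨD hΨper hΨvan =>
    exists_refutation_of_jet_identity hm i₀ y hy e he Ψ hΨD hΨper hΨvan

end Main

end Summit.ValiantsHypothesis.ValiantsHypothesis.Theorems.RefutationDegreeBeyondHessianNs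

end
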